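import Literature.RepresentationTheory.FiniteGroups.IrreducibleCharacters
import Literature.RepresentationTheory.FiniteGroups.BrauerInduction
import HarnessLib

/-!
# The irreducible characters of a direct product `K × L`

Topic `Literature/RepresentationTheory/FiniteGroups`.  Serre, *Linear Representations of Finite
Groups*, §3.2 Thm. 10: for finite groups `K`, `L`,

  (i)  if `ψ`, `φ` are irreducible characters of `K`, `L`, then the external product
       `ψ ⊠ φ : (k, l) ↦ ψ(k) φ(l)` (the character of `ρ₁ ⊗ ρ₂`) is an irreducible character of `K × L`;
  (ii) every irreducible character of `K × L` is of this form.

In the language of the topic files (`IsCharacter`, `IsIrrChar`, `irrChars`, `classInner`):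

* `IsCharacter.isIrrChar_of_classInner_eq_one` — a character with `⟨χ, χ⟩ = 1` is irreducible
  (Serre §2.3 Thm. 5);
* `IsCharacter.boxProd`, `classInner_boxProd`, `IsIrrChar.boxProd` — (i): `ψ ⊠ φ` is the character of the
  tensor product of the inflated representations (`Representation.tprod`, `Representation.char_tensor`)
  and `⟨ψ ⊠ φ, ψ' ⊠ φ'⟩_{K × L} = ⟨ψ, ψ'⟩_K ⟨φ, φ'⟩_L`;
* `character_leftRegular_eq_sum_smul`, `character_leftRegular_prod`, `exists_eq_boxProd_of_mem_irrChars`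
  — (ii), by Serre's counting-free argument through the regular character: `r_{K × L} = r_K ⊠ r_L =
  ∑_{ψ, φ} ψ(1) φ(1) · ψ ⊠ φ` and `⟨r_{K×L}, χ⟩ = χ(1) ≠ 0`, so an irreducible `χ` is not orthogonal to,
  hence equal to, some `ψ ⊠ φ`.

These statements were first proved in the tree inside a route file
(`Summits/MatrixMultiplication/…/LevelGradedCohnUmansGradedDesignFamilyStubProdBudget.lean`,
`prodBudget_*`); this is their topic-file (Literature) form, with the same proofs.  Everything is
proved; no definition is introduced (the external product is written `fun p => ψ p.1 * φ p.2`).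

## References

* J.-P. Serre, *Linear Representations of Finite Groups*, GTM 42 (1977), §2.3 Thm. 5, §2.4
  Prop. 5 and Cor. 1, §3.2 Thm. 10 [SerreLinearRepresentations1977].
-/

noncomputable section

open scoped BigOperators TensorProduct
open Module

namespace Literature.RepresentationTheory.FiniteGroups

/-! ### A character of norm one is irreducible -/

/-- **A character `χ` with `⟨χ, χ⟩ = 1` is irreducible** (Serre, *Linear Representations*, §2.3
Thm. 5): writing `χ = ∑_{χ' ∈ m} χ'` with irreducible `χ'`, `⟨χ, χ⟩ = ∑_{χ' ∈ m} (multiplicity of χ')`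
is a sum of `card m` positive integers. [cite: SerreLinearRepresentations1977, §2.3 Thm. 5] -/
theorem IsCharacter.isIrrChar_of_classInner_eq_one {G : Type} [Group G] [Fintype G] {χ : G → ℂ}
    (hχ : IsCharacter G χ) (h1 : classInner χ χ = 1) : IsIrrChar G χ := by
  classical
  obtain ⟨m, hm, rfl⟩ := hχ.exists_multiset_irrChars
  have hsum : ((m.map fun χ' => m.count χ').sum : ℂ) = classInner m.sum m.sum := by
    rw [classInner_multiset_sum_left, Nat.cast_multiset_sum, Multiset.map_map]
    congr 1
    refine Multiset.map_congr rfl fun χ' hχ' => ?_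
    rw [Function.comp_apply, classInner_comm, classInner_multiset_sum_irrChars hm (hm χ' hχ')]
  rw [h1] at hsum
  have hnat : (m.map fun χ' => m.count χ').sum = 1 := by exact_mod_cast hsum
  have hcard : m.card ≤ 1 := by
    calc m.card = (m.map fun _ => 1).sum := by simp
      _ ≤ (m.map fun χ' => m.count χ').sum :=
          Multiset.sum_map_le_sum_map _ _ fun χ' h => Multiset.one_le_count_iff_mem.mpr h
      _ = 1 := hnat
  have hne : m ≠ 0 := by
    rintro rfl
    simp at hnat
  obtain ⟨χ₀, rfl⟩ := Multiset.card_eq_one.mp (le_antisymm hcard (Multiset.card_pos.mpr hne))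
  rw [Multiset.sum_singleton]
  exact hm χ₀ (Multiset.mem_singleton_self χ₀)

/-- An irreducible character does not vanish at `1` (its degree is the dimension of a non-zero
space). [folklore] -/
theorem IsIrrChar.apply_one_ne_zero {G : Type} [Group G] {χ : G → ℂ} (h : IsIrrChar G χ) :
    χ 1 ≠ 0 := by
  obtain ⟨V, _, _, _, ρ, hρ, rfl⟩ := h
  haveI := hρ
  haveI : Nontrivial V := by
    by_contra hV
    rw [not_nontrivial_iff_subsingleton] at hV
    have hbt : (⊥ : Subrepresentation ρ) = ⊤ :=
      Subrepresentation.toSubmodule_injective (Subsingleton.elim _ _)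
    exact (IsSimpleOrder.bot_ne_top (α := Subrepresentation ρ)) hbt
  rw [Representation.char_one]
  exact Nat.cast_ne_zero.mpr Module.finrank_pos.ne'

/-! ### External products of characters -/

section BoxProd

variable {K L : Type} [Group K] [Group L]

/-- **The external product `ψ ⊠ φ : (k, l) ↦ ψ(k) φ(l)` of characters is a character of `K × L`**:
the character of the tensor product of the representations inflated along the two projections
(`Representation.tprod`, `Representation.char_tensor`). [cite: SerreLinearRepresentations1977, §3.2 Thm. 10] -/
theorem IsCharacter.boxProd {ψ : K → ℂ} {φ : L → ℂ} (hψ : IsCharacter K ψ) (hφ : IsCharacter L φ) :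
    IsCharacter (K × L) (fun p => ψ p.1 * φ p.2) := by
  obtain ⟨V, _, _, _, ρ, rfl⟩ := hψ
  obtain ⟨W, _, _, _, σ, rfl⟩ := hφ
  refine ⟨V ⊗[ℂ] W, inferInstance, inferInstance, inferInstance,
    Representation.tprod (ρ.comp (MonoidHom.fst K L)) (σ.comp (MonoidHom.snd K L)), ?_⟩
  rw [Representation.char_tensor]
  funext p
  rfl

variable [Fintype K] [Fintype L]

/-- `⟨ψ ⊠ φ, ψ' ⊠ φ'⟩_{K × L} = ⟨ψ, ψ'⟩_K · ⟨φ, φ'⟩_L`. [folklore] -/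
theorem classInner_boxProd (ψ ψ' : K → ℂ) (φ φ' : L → ℂ) :
    classInner (fun p : K × L => ψ p.1 * φ p.2) (fun p => ψ' p.1 * φ' p.2) =
      classInner ψ ψ' * classInner φ φ' := by
  simp only [classInner_apply]
  rw [Fintype.card_prod, Nat.cast_mul, mul_inv, Fintype.sum_prod_type, mul_mul_mul_comm,
    Finset.sum_mul_sum]
  congr 1
  refine Finset.sum_congr rfl fun k _ => Finset.sum_congr rfl fun l _ => ?_
  simp only [Prod.inv_mk]
  ring

/-- **Serre §3.2 Thm. 10 (i): the external product of irreducible characters is an irreducible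
character of `K × L`** (`⟨ψ ⊠ φ, ψ ⊠ φ⟩ = ⟨ψ, ψ⟩ ⟨φ, φ⟩ = 1`). [cite: SerreLinearRepresentations1977, §3.2 Thm. 10] -/
theorem IsIrrChar.boxProd {ψ : K → ℂ} {φ : L → ℂ} (hψ : IsIrrChar K ψ) (hφ : IsIrrChar L φ) :
    IsIrrChar (K × L) (fun p => ψ p.1 * φ p.2) := by
  refine (hψ.isCharacter.boxProd hφ.isCharacter).isIrrChar_of_classInner_eq_one ?_
  rw [classInner_boxProd, hψ.classInner_eq hψ, hφ.classInner_eq hφ, if_pos rfl, if_pos rfl, mul_one]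

/-- Membership form of (i): `ψ ⊠ φ ∈ Irr(K × L)` for `ψ ∈ Irr(K)`, `φ ∈ Irr(L)`.
[cite: SerreLinearRepresentations1977, §3.2 Thm. 10] -/
theorem boxProd_mem_irrChars {ψ : K → ℂ} {φ : L → ℂ} (hψ : ψ ∈ irrChars K) (hφ : φ ∈ irrChars L) :
    (fun p : K × L => ψ p.1 * φ p.2) ∈ irrChars (K × L) :=
  IsIrrChar.boxProd hψ hφ

/-! ### Completeness through the regular character -/

/-- The regular character is `∑_{ψ irreducible} ψ(1) ψ` (Serre §2.4 Cor. 1: `⟨r_G, ψ⟩ = ψ(1)`).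
[cite: SerreLinearRepresentations1977, §2.4 Cor. 1] -/
theorem character_leftRegular_eq_sum_smul {G : Type} [Group G] [Fintype G] :
    (Representation.leftRegular ℂ G).character =
      ∑ ψ ∈ (irrChars_finite_holds G).toFinset, ψ 1 • ψ := by
  refine ((isCharacter_leftRegular (G := G)).isClassFun.eq_sum_classInner_smul).trans ?_
  exact Finset.sum_congr rfl fun ψ _ => by rw [classInner_leftRegular]

/-- The regular character of `K × L` is the external product of the regular characters
(Serre §2.4 Prop. 5: `r(1) = |G|`, `r(s) = 0` otherwise). [cite: SerreLinearRepresentations1977, §2.4 Prop. 5] -/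
theorem character_leftRegular_prod (p : K × L) :
    (Representation.leftRegular ℂ (K × L)).character p =
      (Representation.leftRegular ℂ K).character p.1 *
        (Representation.leftRegular ℂ L).character p.2 := by
  classical
  obtain ⟨k, l⟩ := p
  rw [character_leftRegular, character_leftRegular, character_leftRegular, Fintype.card_prod,
    Nat.cast_mul]
  simp only [Prod.mk_eq_one]
  by_cases hk : k = 1 <;> by_cases hl : l = 1 <;> simp [hk, hl]

/-- **Serre §3.2 Thm. 10 (ii): every irreducible character of `K × L` is an external product
`ψ ⊠ φ` of irreducible characters** — otherwise `χ(1) = ⟨r_{K × L}, χ⟩ = ∑_{ψ, φ} ψ(1) φ(1) ⟨ψ ⊠ φ, χ⟩`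
would vanish by orthonormality. [cite: SerreLinearRepresentations1977, §3.2 Thm. 10] -/
theorem exists_eq_boxProd_of_mem_irrChars {χ : K × L → ℂ} (hχ : χ ∈ irrChars (K × L)) :
    ∃ ψ ∈ irrChars K, ∃ φ ∈ irrChars L, χ = fun p => ψ p.1 * φ p.2 := by
  classical
  have hχi : IsIrrChar (K × L) χ := hχ
  by_contra hne
  apply hχi.apply_one_ne_zero
  rw [← classInner_leftRegular χ]
  have hreg : (Representation.leftRegular ℂ (K × L)).character =
      ∑ ψ ∈ (irrChars_finite_holds K).toFinset, ∑ φ ∈ (irrChars_finite_holds L).toFinset,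
        (ψ 1 * φ 1) • fun p : K × L => ψ p.1 * φ p.2 := by
    funext p
    rw [character_leftRegular_prod, character_leftRegular_eq_sum_smul,
      character_leftRegular_eq_sum_smul]
    simp only [Finset.sum_apply, Pi.smul_apply, smul_eq_mul, Finset.sum_mul_sum]
    refine Finset.sum_congr rfl fun ψ _ => Finset.sum_congr rfl fun φ _ => ?_
    ring
  rw [hreg, classInner_sum_left]
  refine Finset.sum_eq_zero fun ψ hψ => ?_
  rw [classInner_sum_left]
  refine Finset.sum_eq_zero fun φ hφ => ?_
  have hψ' : IsIrrChar K ψ := (irrChars_finite_holds K).mem_toFinset.mp hψ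
  have hφ' : IsIrrChar L φ := (irrChars_finite_holds L).mem_toFinset.mp hφ
  rw [classInner_smul_left, (hψ'.boxProd hφ').classInner_eq hχi,
    if_neg (fun h => hne ⟨ψ, hψ', φ, hφ', h.symm⟩), mul_zero]

omit [Fintype K] [Fintype L] in
/-- The degree of an external product is the product of the degrees. [folklore] -/
theorem boxProd_apply_one (ψ : K → ℂ) (φ : L → ℂ) :
    (fun p : K × L => ψ p.1 * φ p.2) 1 = ψ 1 * φ 1 := rfl

end BoxProd

end Literature.RepresentationTheory.FiniteGroups

end
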